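import Mathlib.NumberTheory.Padics.RingHoms
import Mathlib.NumberTheory.Padics.ProperSpace
import Mathlib.Topology.MetricSpace.Ultra.TotallySeparated
import Literature.AnabelianGeometry.SemiGraphs.TemperedAnabelianProfiniteCompletion

/-!
# [SemiAnbd] Lemma 6.1 (ii)/(iii) are NOT consequences of the §6 interface: a dense-lattice inhabitant

PROOF-ONLY companion (abc-iut seat f-092, F fact-proving wave FLOAT, rung LADDER-ABC:A2.C) of abc-iut-L3-t2's
`TemperedAnabelian.lean` (p403906, FROZEN; imported, never edited).  S. Mochizuki, *Semi-graphs of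
anabelioids*, Publ. RIMS **42** (2006) [SemiAnbd] §6, Lemma 6.1 p. 69: «(ii) `N_{Δ_X}(Δ^temp_X) = Δ^temp_X`.
(iii) `N_{Π_{X_K}}(Π^temp_{X_K}) = Π^temp_{X_K}`. … Assertion (iii) follows immediately from assertion (ii).»
The tree types (ii)/(iii) as the BY-DESIGN predicates `TemperedCurve.DeltaTempNormallyTerminal` (FACT-LIST
F-1663) and `TemperedCurve.PiTempNormallyTerminal` (F-1678; ≡ the pointer row F-0256 `prop410_i_ii_pointer`
of [AbsTopI] Prop 4.10 (ii), `AbsoluteAnabelian.prop410_i_ii_pointer_iff`) on the §6 interface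
`TemperedCurve p`; abc-iut-L3 discharges them MODULO structural inputs (`IsTempered`, tower data:
`TemperedDeltaNormalizers.lean`, `TemperedAnabelianLem63iiiProofs.lean`), and they HOLD at the consistency
inhabitant `TemperedCurve.degenerate p` (`AbsoluteAnabelian.piTempNormallyTerminal_degenerate`, p428617).

THIS FILE shows the structural inputs are NOT idle: the interface axioms of `TemperedCurve p` ALONE do not
imply Lemma 6.1 (ii) or (iii).  For (iii) alone this is abc-iut-w6-d028's `not_forall_piTempNormallyTerminal`
(`TemperedCurveDiscreteRankOneWitness.lean`: `Π^temp := ℤ × G_{ℚ_p}` with `ℤ` DISCRETE, `Π := Ẑ × G_{ℚ_p}`);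
the witness here is different in kind (INDUCED topology, via the dense-subgroup completion theorem) and
settles (ii) as well, at the same datum.  `exists_temperedCurve_not_normallyTerminal` builds an inhabitant
`X` of `TemperedCurve p` — base field `ℚ_p`; «`Π̂`» `:= G_{ℚ_p} × ℤ_p` (profinite); «`Π^temp`» `:=` the DENSE
subgroup `G_{ℚ_p} × ℤ` with the induced topology, whose inclusion IS a profinite completion in the typed
sense (`isProfiniteCompletion_subgroup_of_dense`, p429193); augmentation = first projection; no closed
points — at which BOTH predicates FAIL: `Π^temp` and `Δ^temp = 1 × ℤ` are normal, non-closed, dense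
subgroups of `Π̂` resp. `Δ̂ = 1 × ℤ_p`, so their normalizers are everything (`(1 + p)⁻¹ ∈ ℤ_p ∖ ℤ`
witnesses properness).  Consequences: `not_forall_deltaTempNormallyTerminal` (F-1663, universal closure
REFUTED — new) and `not_forall_deltaTemp_and_piTempNormallyTerminal` (joint form; the (iii)-only closure
refutation is w6-d028's `not_forall_piTempNormallyTerminal`, not restated); with p428617's
`AbsoluteAnabelian.piTempNormallyTerminal_degenerate` both predicates take both truth values on the interface.

HONEST FRAMING: a statement about OUR typed interface (whose inhabitants need not be tempered fundamental
groups of curves: here `Π^temp` is abelian-by-profinite and not the `π₁^temp` of anything); it says nothing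
about print's Lemma 6.1, which concerns the genuine `Π^temp_{X_K}` ([André] Cor. 6.2.2); no bearing on, and
no side taken on, [IUTchIII] Cor 3.12; typed ≠ proved.
-/

noncomputable section

namespace Literature.AnabelianGeometry.SemiGraphs

open _root_.Topology _root_.Set
open scoped Pointwise

/-- A `p`-adic integer which is not a rational integer: `(1 + p)⁻¹ ∈ ℤ_p ∖ ℤ` (auxiliary; `1 + p` is a
unit of `ℤ_p`, and `n (1 + p) = 1` has no solution in `ℤ`). [cite: MochizukiSemiAnbd2006, §6 p.69] -/
theorem exists_padicInt_not_intCast (p : ℕ) [hp : Fact p.Prime] :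
    ∃ w : ℤ_[p], ∀ n : ℤ, (n : ℤ_[p]) ≠ w := by
  have hnp : ‖(p : ℤ_[p])‖ < 1 := by
    rw [PadicInt.norm_p]
    exact inv_lt_one_of_one_lt₀ (by exact_mod_cast hp.out.one_lt)
  have hu : IsUnit ((1 : ℤ_[p]) + p) := by
    rw [PadicInt.isUnit_iff]
    have h1 : ‖(1 : ℤ_[p])‖ = 1 := norm_one
    rw [PadicInt.norm_add_eq_max_of_ne (by rw [h1]; exact hnp.ne'), h1, max_eq_left hnp.le]
  refine ⟨((hu.unit⁻¹ : ℤ_[p]ˣ) : ℤ_[p]), fun n hn => ?_⟩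
  have hmul : (n : ℤ_[p]) * (1 + p) = 1 := by
    have h := hu.unit.inv_mul
    rw [IsUnit.unit_spec] at h
    rwa [hn]
  have hcast : ((n * (1 + p) : ℤ) : ℤ_[p]) = ((1 : ℤ) : ℤ_[p]) := by
    push_cast
    exact hmul
  have hZ : n * (1 + (p : ℤ)) = 1 := Int.cast_injective hcast
  have hp2 : 2 ≤ (p : ℤ) := by exact_mod_cast hp.out.two_le
  rcases Int.eq_one_or_neg_one_of_mul_eq_one hZ with rfl | rfl <;> omega

/-- **[SemiAnbd] Lemma 6.1 (ii)/(iii) are independent of the §6 interface.**  There is an inhabitant `X` of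
`TemperedCurve p` (base field `ℚ_p`; `Π̂ := G_{ℚ_p} × ℤ_p`; `Π^temp :=` the dense subgroup `G_{ℚ_p} × ℤ`
with the induced topology, a profinite completion in the typed sense by
`isProfiniteCompletion_subgroup_of_dense`; augmentation the first projection; no closed points) for which
BOTH `X.DeltaTempNormallyTerminal` (F-1663, `N_{Δ_X}(Δ^temp_X) = Δ^temp_X`) and `X.PiTempNormallyTerminal`
(F-1678, `N_{Π_{X_K}}(Π^temp_{X_K}) = Π^temp_{X_K}`) FAIL: `Δ^temp = 1 × ℤ ⊊ Δ̂ = 1 × ℤ_p` and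
`Π^temp ⊊ Π̂` are normal dense proper subgroups, so each normalizer is the whole group.
[cite: MochizukiSemiAnbd2006, Lem 6.1(iii) p.69] -/
theorem exists_temperedCurve_not_normallyTerminal (p : ℕ) [hp : Fact p.Prime] :
    ∃ X : TemperedCurve p, ¬ X.DeltaTempNormallyTerminal ∧ ¬ X.PiTempNormallyTerminal := by
  classical
  -- the two profinite factors
  haveI : IsGalois ℚ_[p] (AlgebraicClosure ℚ_[p]) := {}
  haveI : T2Space (GQp p) := krullTopology_t2
  letI : TopologicalSpace (Multiplicative ℤ_[p]) := inferInstance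
  haveI : CompactSpace (Multiplicative ℤ_[p]) := inferInstanceAs (CompactSpace ℤ_[p])
  haveI : T2Space (Multiplicative ℤ_[p]) := inferInstanceAs (T2Space ℤ_[p])
  haveI : TotallyDisconnectedSpace (Multiplicative ℤ_[p]) :=
    inferInstanceAs (TotallyDisconnectedSpace ℤ_[p])
  haveI : IsTopologicalGroup (Multiplicative ℤ_[p]) := inferInstance
  -- the dense lattice `A₀ = ℤ ⊆ ℤ_p` (written multiplicatively) and `H = G_{ℚ_p} × A₀ ⊆ Π̂`
  set a : Multiplicative ℤ_[p] := Multiplicative.ofAdd (1 : ℤ_[p]) with ha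
  set A₀ : Subgroup (Multiplicative ℤ_[p]) := Subgroup.zpowers a with hA₀
  have hmemA₀ : ∀ w : ℤ_[p], Multiplicative.ofAdd w ∈ A₀ ↔ ∃ n : ℤ, (n : ℤ_[p]) = w := by
    intro w
    rw [hA₀, Subgroup.mem_zpowers_iff]
    constructor
    · rintro ⟨n, hn⟩
      refine ⟨n, ?_⟩
      rw [ha, ← ofAdd_zsmul, Int.smul_one_eq_cast] at hn
      exact Multiplicative.ofAdd.injective hn
    · rintro ⟨n, rfl⟩
      exact ⟨n, by rw [ha, ← ofAdd_zsmul, Int.smul_one_eq_cast]⟩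
  have hA₀dense : Dense (A₀ : Set (Multiplicative ℤ_[p])) := by
    have hrange : (A₀ : Set (Multiplicative ℤ_[p])) =
        range (Multiplicative.ofAdd ∘ (Int.cast : ℤ → ℤ_[p])) := by
      ext x
      constructor
      · intro hx
        obtain ⟨n, hn⟩ := (hmemA₀ (Multiplicative.toAdd x)).mp (by simpa using hx)
        exact ⟨n, by simp [hn]⟩
      · rintro ⟨n, rfl⟩
        exact (hmemA₀ _).mpr ⟨n, rfl⟩
    rw [hrange]
    exact (Multiplicative.ofAdd.surjective.denseRange.comp PadicInt.denseRange_intCast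
      continuous_ofAdd)
  set H : Subgroup (GQp p × Multiplicative ℤ_[p]) := (⊤ : Subgroup (GQp p)).prod A₀ with hH
  have hmemH : ∀ y : GQp p × Multiplicative ℤ_[p], y ∈ H ↔ y.2 ∈ A₀ := fun y => by
    rw [hH, Subgroup.mem_prod]
    simp
  have hHdense : Dense (H : Set (GQp p × Multiplicative ℤ_[p])) := by
    rw [hH, Subgroup.coe_prod, Subgroup.coe_top]
    exact dense_univ.prod hA₀dense
  haveI hHnormal : H.Normal := ⟨fun y hy g => by
    rw [hmemH] at hy ⊢
    simpa [mul_comm] using hy⟩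
  -- the inclusion `H ↪ Π̂` is a profinite completion in the typed sense
  let ι : H →ₜ* (GQp p × Multiplicative ℤ_[p]) :=
    { H.subtype with continuous_toFun := continuous_subtype_val }
  have hι : IsProfiniteCompletion ι := isProfiniteCompletion_subgroup_of_dense H hHdense
  have hιrange : ι.toMonoidHom.range = H := Subgroup.range_subtype H
  -- a point of `Π̂` outside `H`
  obtain ⟨w, hw⟩ := exists_padicInt_not_intCast p
  have hwA₀ : Multiplicative.ofAdd w ∉ A₀ := fun h => by
    obtain ⟨n, hn⟩ := (hmemA₀ w).mp h
    exact hw n hn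
  have hnotH : ((1 : GQp p), Multiplicative.ofAdd w) ∉ H := fun h => hwA₀ ((hmemH _).mp h)
  -- the inhabitant
  let X : TemperedCurve p :=
    { K := ⊥
      finiteDimensional_K := inferInstance
      PiTemp := H
      aug := (ContinuousMonoidHom.fst (GQp p) (Multiplicative ℤ_[p])).comp ι
      range_aug := by
        rw [IntermediateField.fixingSubgroup_bot]
        exact MonoidHom.range_eq_top.mpr fun g =>
          ⟨⟨(g, 1), (hmemH _).mpr A₀.one_mem⟩, rfl⟩
      PiHat := GQp p × Multiplicative ℤ_[p]
      toHat := ι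
      isProfiniteCompletion_toHat := hι
      toHat_injective := Subtype.val_injective
      augHat := ContinuousMonoidHom.fst (GQp p) (Multiplicative ℤ_[p])
      augHat_comp := fun _ => rfl
      Pt := PEmpty
      IsCusp := fun x => x.elim
      decomp := fun x => x.elim
      isClosed_decomp := fun x => x.elim
      isOpen_aug_decomp := fun x => x.elim
      inertia_eq_bot := fun x => x.elim
      inertia_equiv_zHat := fun x => x.elim }
  -- the image `D` of `Δ^temp = Ker(aug)` in `Π̂` and its closure `Δ̂`
  have hD : ({(1 : GQp p)} ×ˢ (A₀ : Set (Multiplicative ℤ_[p]))) ⊆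
      (X.DeltaTemp.map X.toHat.toMonoidHom : Set (GQp p × Multiplicative ℤ_[p])) := by
    rintro ⟨g, b⟩ ⟨hg, hb⟩
    rw [mem_singleton_iff] at hg
    subst hg
    refine ⟨⟨(1, b), (hmemH _).mpr hb⟩, ?_, rfl⟩
    change (⟨(1, b), _⟩ : H) ∈ X.aug.toMonoidHom.ker
    rw [MonoidHom.mem_ker]
    rfl
  have hDsub : (X.DeltaTemp.map X.toHat.toMonoidHom : Set (GQp p × Multiplicative ℤ_[p])) ⊆
      {y | y.1 = 1} := by
    rintro _ ⟨x, hx, rfl⟩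
    have hx' : x ∈ X.aug.toMonoidHom.ker := hx
    rw [MonoidHom.mem_ker] at hx'
    exact hx'
  have hDhat_sub : (X.DeltaHat : Set (GQp p × Multiplicative ℤ_[p])) ⊆ {y | y.1 = 1} := by
    change closure _ ⊆ _
    exact closure_minimal hDsub (isClosed_eq continuous_fst continuous_const)
  have hwDhat : ((1 : GQp p), Multiplicative.ofAdd w) ∈ X.DeltaHat := by
    change ((1 : GQp p), Multiplicative.ofAdd w) ∈ closure _
    refine closure_mono hD ?_
    rw [closure_prod_eq, closure_singleton, hA₀dense.closure_eq]
    exact ⟨rfl, mem_univ _⟩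
  refine ⟨X, ?_, ?_⟩
  · -- (ii) fails: `Δ̂` is abelian, so the normalizer of the image of `Δ^temp` is all of `Δ̂ ∌̸ (1, w)`
    intro h
    unfold TemperedCurve.DeltaTempNormallyTerminal at h
    set Dsub : Subgroup X.DeltaHat := (X.DeltaTemp.map X.toHat.toMonoidHom).subgroupOf X.DeltaHat
      with hDsub_def
    have hcomm : ∀ y z : X.DeltaHat, y * z = z * y := fun y z => by
      have hy := hDhat_sub y.2
      have hz := hDhat_sub z.2
      simp only [mem_setOf_eq] at hy hz
      refine Subtype.ext (Prod.ext ?_ ?_)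
      · change y.1.1 * z.1.1 = z.1.1 * y.1.1
        rw [hy, hz]
      · change y.1.2 * z.1.2 = z.1.2 * y.1.2
        exact mul_comm _ _
    haveI : Dsub.Normal := ⟨fun n hn g => by
      rw [hcomm g n, mul_inv_cancel_right]
      exact hn⟩
    have htop : Dsub = ⊤ := by
      rw [← h]
      exact Subgroup.normalizer_eq_top (H := Dsub)
    have hmem : (⟨((1 : GQp p), Multiplicative.ofAdd w), hwDhat⟩ : X.DeltaHat) ∈ Dsub := by
      rw [htop]; exact Subgroup.mem_top _
    rw [hDsub_def, Subgroup.mem_subgroupOf] at hmem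
    obtain ⟨x, -, hx⟩ := hmem
    have hx' : (x : GQp p × Multiplicative ℤ_[p]) = ((1 : GQp p), Multiplicative.ofAdd w) := hx
    exact hnotH (hx' ▸ x.2)
  · -- (iii) fails: `Π^temp = H` is normal in `Π̂`, so its normalizer is everything `∌̸ (1, w)`
    intro h
    unfold TemperedCurve.PiTempNormallyTerminal at h
    change Subgroup.normalizer (ι.toMonoidHom.range : Set (GQp p × Multiplicative ℤ_[p])) =
      ι.toMonoidHom.range at h
    rw [hιrange, Subgroup.normalizer_eq_top (H := H)] at h
    exact hnotH (h ▸ Subgroup.mem_top _)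

/-- **F-1663 ∧ F-1678 jointly**: the conjunction «Lemma 6.1 (ii) and (iii) hold for every inhabitant of the
§6 interface» is REFUTED at one datum (kernel witness above; the (iii)-only closure refutation is
abc-iut-w6-d028's `not_forall_piTempNormallyTerminal`, a discrete rank-one datum).  L3's discharge modulo
`IsTempered` + tower data is therefore not vacuously strong. [cite: MochizukiSemiAnbd2006, Lem 6.1(iii) p.69] -/
theorem not_forall_deltaTemp_and_piTempNormallyTerminal (p : ℕ) [Fact p.Prime] :
    ¬ ∀ X : TemperedCurve p, X.DeltaTempNormallyTerminal ∨ X.PiTempNormallyTerminal := fun h => by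
  obtain ⟨X, hX, hX'⟩ := exists_temperedCurve_not_normallyTerminal p
  exact (h X).elim hX hX'

/-- **F-1663 / [SemiAnbd] Lemma 6.1 (ii), UNIVERSAL CLOSURE REFUTED**: it is NOT the case that every
inhabitant of the §6 interface has `Δ^temp` normally terminal in `Δ̂` (same witness: `Δ^temp = 1 × ℤ` is
dense and normal in the abelian `Δ̂ = 1 × ℤ_p`). [cite: MochizukiSemiAnbd2006, Lem 6.1(ii) p.69] -/
theorem not_forall_deltaTempNormallyTerminal (p : ℕ) [Fact p.Prime] :
    ¬ ∀ X : TemperedCurve p, X.DeltaTempNormallyTerminal := fun h => by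
  obtain ⟨X, hX, -⟩ := exists_temperedCurve_not_normallyTerminal p
  exact hX (h X)

/-! ### Lemma 6.3 (iii) at the same inhabitant (appended, abc-iut-f-092) -/

/-- **[SemiAnbd] Lemma 6.3 (iii) fails at the dense-lattice inhabitant, for BOTH `F = Π^temp_{X_K}`
(`PiTempDenseDOFConjugator`, F-1677) AND `F = Δ^temp_X` (`DeltaTempDenseDOFConjugator`, F-1662).**  At the
inhabitant `X` of `exists_temperedCurve_not_normallyTerminal` (rebuilt here verbatim: `Π̂ := G_{ℚ_p} × ℤ_p`,
`Π^temp := G_{ℚ_p} × ℤ` with the induced topology, augmentation the first projection) take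
`F₁ = F₂ := F` (of DOF-type: `F` is open of finite index in itself; dense in `F̂`) and `f := (1, w)` with
`w ∈ ℤ_p ∖ ℤ`: `f · F · f⁻¹ = F` because `Π^temp` is normal in `Π̂` (resp. `Δ̂ = 1 × ℤ_p` is abelian),
yet `f ∉ F`.  Lemma 6.3 (iii) p. 70: «for any `f ∈ F̂` such that `f · F₁ · f⁻¹ = F₂`, it follows that
`f ∈ F`».  The `Π^temp` case at a DISCRETE rank-one datum is abc-iut-w6-d028's
`not_forall_piTempDenseDOFConjugator` (cited, not restated); the `Δ^temp` case is new.  By-design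
predicates: consumable at certified instances only. [cite: MochizukiSemiAnbd2006, Lem 6.3(iii) p.70] -/
theorem exists_temperedCurve_not_denseDOFConjugator (p : ℕ) [hp : Fact p.Prime] :
    ∃ X : TemperedCurve p, ¬ X.PiTempDenseDOFConjugator ∧ ¬ X.DeltaTempDenseDOFConjugator := by
  classical
  haveI : IsGalois ℚ_[p] (AlgebraicClosure ℚ_[p]) := {}
  haveI : T2Space (GQp p) := krullTopology_t2
  letI : TopologicalSpace (Multiplicative ℤ_[p]) := inferInstance
  haveI : CompactSpace (Multiplicative ℤ_[p]) := inferInstanceAs (CompactSpace ℤ_[p])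
  haveI : T2Space (Multiplicative ℤ_[p]) := inferInstanceAs (T2Space ℤ_[p])
  haveI : TotallyDisconnectedSpace (Multiplicative ℤ_[p]) := inferInstanceAs (TotallyDisconnectedSpace ℤ_[p])
  haveI : IsTopologicalGroup (Multiplicative ℤ_[p]) := inferInstance
  set a : Multiplicative ℤ_[p] := Multiplicative.ofAdd (1 : ℤ_[p]) with ha
  set A₀ : Subgroup (Multiplicative ℤ_[p]) := Subgroup.zpowers a with hA₀
  have hmemA₀ : ∀ w : ℤ_[p], Multiplicative.ofAdd w ∈ A₀ ↔ ∃ n : ℤ, (n : ℤ_[p]) = w := by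
    intro w
    rw [hA₀, Subgroup.mem_zpowers_iff]
    constructor
    · rintro ⟨n, hn⟩
      refine ⟨n, ?_⟩
      rw [ha, ← ofAdd_zsmul, Int.smul_one_eq_cast] at hn
      exact Multiplicative.ofAdd.injective hn
    · rintro ⟨n, rfl⟩
      exact ⟨n, by rw [ha, ← ofAdd_zsmul, Int.smul_one_eq_cast]⟩
  have hA₀dense : Dense (A₀ : Set (Multiplicative ℤ_[p])) := by
    have hrange : (A₀ : Set (Multiplicative ℤ_[p])) =
        range (Multiplicative.ofAdd ∘ (Int.cast : ℤ → ℤ_[p])) := by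
      ext x
      constructor
      · intro hx
        obtain ⟨n, hn⟩ := (hmemA₀ (Multiplicative.toAdd x)).mp (by simpa using hx)
        exact ⟨n, by simp [hn]⟩
      · rintro ⟨n, rfl⟩
        exact (hmemA₀ _).mpr ⟨n, rfl⟩
    rw [hrange]
    exact Multiplicative.ofAdd.surjective.denseRange.comp PadicInt.denseRange_intCast continuous_ofAdd
  set H : Subgroup (GQp p × Multiplicative ℤ_[p]) := (⊤ : Subgroup (GQp p)).prod A₀ with hH
  have hmemH : ∀ y : GQp p × Multiplicative ℤ_[p], y ∈ H ↔ y.2 ∈ A₀ := fun y => by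
    rw [hH, Subgroup.mem_prod]
    simp
  have hHdense : Dense (H : Set (GQp p × Multiplicative ℤ_[p])) := by
    rw [hH, Subgroup.coe_prod, Subgroup.coe_top]
    exact dense_univ.prod hA₀dense
  haveI hHnormal : H.Normal := ⟨fun y hy g => by
    rw [hmemH] at hy ⊢
    simpa [mul_comm] using hy⟩
  let ι : H →ₜ* (GQp p × Multiplicative ℤ_[p]) :=
    { H.subtype with continuous_toFun := continuous_subtype_val }
  have hι : IsProfiniteCompletion ι := isProfiniteCompletion_subgroup_of_dense H hHdense
  have hιrange : ι.toMonoidHom.range = H := Subgroup.range_subtype H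
  obtain ⟨w, hw⟩ := exists_padicInt_not_intCast p
  have hwA₀ : Multiplicative.ofAdd w ∉ A₀ := fun h => by
    obtain ⟨n, hn⟩ := (hmemA₀ w).mp h
    exact hw n hn
  have hnotH : ((1 : GQp p), Multiplicative.ofAdd w) ∉ H := fun h => hwA₀ ((hmemH _).mp h)
  let X : TemperedCurve p :=
    { K := ⊥
      finiteDimensional_K := inferInstance
      PiTemp := H
      aug := (ContinuousMonoidHom.fst (GQp p) (Multiplicative ℤ_[p])).comp ι
      range_aug := by
        rw [IntermediateField.fixingSubgroup_bot]
        exact MonoidHom.range_eq_top.mpr fun g => ⟨⟨(g, 1), (hmemH _).mpr A₀.one_mem⟩, rfl⟩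
      PiHat := GQp p × Multiplicative ℤ_[p]
      toHat := ι
      isProfiniteCompletion_toHat := hι
      toHat_injective := Subtype.val_injective
      augHat := ContinuousMonoidHom.fst (GQp p) (Multiplicative ℤ_[p])
      augHat_comp := fun _ => rfl
      Pt := PEmpty
      IsCusp := fun x => x.elim
      decomp := fun x => x.elim
      isClosed_decomp := fun x => x.elim
      isOpen_aug_decomp := fun x => x.elim
      inertia_eq_bot := fun x => x.elim
      inertia_equiv_zHat := fun x => x.elim }
  have hD : ({(1 : GQp p)} ×ˢ (A₀ : Set (Multiplicative ℤ_[p]))) ⊆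
      (X.DeltaTemp.map X.toHat.toMonoidHom : Set (GQp p × Multiplicative ℤ_[p])) := by
    rintro ⟨g, b⟩ ⟨hg, hb⟩
    rw [mem_singleton_iff] at hg; subst hg
    refine ⟨⟨(1, b), (hmemH _).mpr hb⟩, ?_, rfl⟩
    change (⟨(1, b), _⟩ : H) ∈ X.aug.toMonoidHom.ker
    rw [MonoidHom.mem_ker]; rfl
  have hDsub : (X.DeltaTemp.map X.toHat.toMonoidHom : Set (GQp p × Multiplicative ℤ_[p])) ⊆
      {y | y.1 = 1} := by
    rintro _ ⟨x, hx, rfl⟩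
    have hx' : x ∈ X.aug.toMonoidHom.ker := hx
    rwa [MonoidHom.mem_ker] at hx'
  have hDhat_sub : (X.DeltaHat : Set (GQp p × Multiplicative ℤ_[p])) ⊆ {y | y.1 = 1} := by
    change closure _ ⊆ _
    exact closure_minimal hDsub (isClosed_eq continuous_fst continuous_const)
  have hwDhat : ((1 : GQp p), Multiplicative.ofAdd w) ∈ X.DeltaHat := by
    change ((1 : GQp p), Multiplicative.ofAdd w) ∈ closure _
    refine closure_mono hD ?_
    rw [closure_prod_eq, closure_singleton, hA₀dense.closure_eq]
    exact ⟨rfl, mem_univ _⟩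
  have hcomm : ∀ y z : X.DeltaHat, y * z = z * y := fun y z => by
    have hy := hDhat_sub y.2
    have hz := hDhat_sub z.2
    simp only [mem_setOf_eq] at hy hz
    refine Subtype.ext (Prod.ext ?_ ?_)
    · change y.1.1 * z.1.1 = z.1.1 * y.1.1
      rw [hy, hz]
    · change y.1.2 * z.1.2 = z.1.2 * y.1.2
      exact mul_comm _ _
  have hDOF : ∀ {G : Type} [Group G] [TopologicalSpace G], IsDOFType (⊤ : Subgroup G) :=
    fun {G} _ _ => ⟨⊤, isOpen_univ, inferInstance, by simp⟩
  refine ⟨X, ?_, ?_⟩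
  · intro h
    have hdense : Dense (X.toHat '' ((⊤ : Subgroup X.PiTemp) : Set X.PiTemp)) := by
      rw [Subgroup.coe_top, image_univ]
      change Dense (range (Subtype.val : H → GQp p × Multiplicative ℤ_[p]))
      rw [Subtype.range_coe]
      exact hHdense
    have hmap : (⊤ : Subgroup X.PiTemp).map X.toHat.toMonoidHom = H := by
      rw [← MonoidHom.range_eq_map]
      exact hιrange
    have key := h ⊤ ⊤ hDOF hDOF hdense hdense
      (ConjAct.toConjAct ((1 : GQp p), Multiplicative.ofAdd w))
      (by rw [hmap]; exact hHnormal.conjAct _)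
    rw [ConjAct.ofConjAct_toConjAct, hιrange] at key
    exact hnotH key
  · intro h
    set f₀ : X.DeltaHat := ⟨((1 : GQp p), Multiplicative.ofAdd w), hwDhat⟩ with hf₀
    have hdense : Dense (X.deltaToHat '' ((⊤ : Subgroup X.DeltaTemp) : Set X.DeltaTemp)) := by
      rw [Subgroup.coe_top, image_univ, Subtype.dense_iff]
      intro y hy
      have hy' : y ∈ closure ((X.DeltaTemp.map X.toHat.toMonoidHom : Subgroup X.PiHat) :
          Set (GQp p × Multiplicative ℤ_[p])) := hy
      refine closure_mono ?_ hy'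
      rintro _ ⟨x, hx, rfl⟩
      exact ⟨X.deltaToHat ⟨x, hx⟩, ⟨⟨x, hx⟩, rfl⟩, rfl⟩
    have hfix : ∀ K : Subgroup X.DeltaHat, ConjAct.toConjAct f₀ • K = K := fun K => by
      ext y
      rw [Subgroup.mem_pointwise_smul_iff_inv_smul_mem, ← ConjAct.toConjAct_inv, ConjAct.toConjAct_smul,
        hcomm f₀⁻¹ y, mul_assoc, mul_inv_cancel, mul_one]
    have key := h ⊤ ⊤ hDOF hDOF hdense hdense (ConjAct.toConjAct f₀) (hfix _)
    rw [ConjAct.ofConjAct_toConjAct] at key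
    obtain ⟨x, hx⟩ := key
    have hx' : (X.toHat x.1 : GQp p × Multiplicative ℤ_[p]) = ((1 : GQp p), Multiplicative.ofAdd w) :=
      congrArg Subtype.val hx
    exact hnotH (hx' ▸ x.1.2)

/-- **F-1662 / [SemiAnbd] Lemma 6.3 (iii) for `F = Δ^temp_X`, UNIVERSAL CLOSURE REFUTED** over the §6
interface (new; the `Π^temp` analogue F-1677 is abc-iut-w6-d028's `not_forall_piTempDenseDOFConjugator`).
[cite: MochizukiSemiAnbd2006, Lem 6.3(iii) p.70] -/
theorem not_forall_deltaTempDenseDOFConjugator (p : ℕ) [Fact p.Prime] :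
    ¬ ∀ X : TemperedCurve p, X.DeltaTempDenseDOFConjugator := fun h => by
  obtain ⟨X, -, hX⟩ := exists_temperedCurve_not_denseDOFConjugator p
  exact hX (h X)

end Literature.AnabelianGeometry.SemiGraphs

end
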